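import Mathlib
import Summits.MatrixMultiplication.MatrixMultiplication.Theses.FidelityWitnesses
import Summits.MatrixMultiplication.MatrixMultiplication.Theorems.FidelityWitnessesDiagonalPowerDecayKoszulWitnessSpectral

/-!
# The quantitative Koszul-flattening witness for `DiagonalPowerDecay` (stmt-MatrixMultiplication-14053)

**Theorem (`koszulWitness`).** For all `n, r` and every tensor `S ∈ ℂ^{(n×n)×(n×n)×(n×n)}` of rank `≤ r`,

  `|⟨S, ⟨n,n,n⟩⟩|² ≤ n·(2r + 3n² + n·(n % 2))/6 · ‖S‖²`,

i.e. `M(n, r) ≤ n³/2 + nr/3 (+ n²/6 for odd n)`.  At the crux's budget `r = n²` this is the first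
`n`-UNIFORM quantitative bound on the captured fraction `φ(n) = M(n,n²)/n³` of the crux
`DiagonalPowerDecay` (`φ(n) ≤ C n^{-2δ}`): `φ(n) ≤ 5/6` for even `n` (`koszulWitness_even`),
`φ(n) ≤ (5n+1)/(6n) ≤ 8/9` for all `n ≥ 2` (`koszulWitness_uniform`) — tree and print had only the
pointwise `φ(n) < 1` (from `bR(⟨n,n,n⟩) ≥ 2n² − n` and witness completeness) and the flattening witness
`M(n,r) ≤ nr`, vacuous at `r = n²`.  It is the fidelity (L²-robust) form of Strassen's commutator /
`p = 1` Koszul-flattening border-rank bound `bR(⟨n,n,n⟩) ≥ 3n²/2` (the bound is trivial exactly at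
`r = 3n²/2`), and it calibrates the crux's barrier: a linear rank method certifies a CONSTANT captured
fraction (here `5/6`; the Koszul family's floor is `1/2`, the cactus floor `1/6`), never a power decay.

**Proof.** (`…KoszulWitnessFrame`, `…KoszulWitnessSpectral`.)  Flatten the first factor by the `p = 1`
Koszul map after each of the `n²` projections `Φ_w : ℂ^{n×n} → ℂ³` (clock-and-shift twirl of an
anticommuting Pauli pair); the twirl is an `L²`-isometry up to `6n`
(`∑_w ⟨K_w(S), K_w(T)⟩_HS = 6n ⟨S,T⟩`, `kwM_inner` + `kwProj_frame`), each `K_w(S)` has rank `≤ 2R(S) ≤ 2r`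
(Landsberg–Ottaviani), so `|⟨K_w(S), K_w(T)⟩| ≤ ‖K_w(S)‖ · (∑_{j ≤ 2r} ‖K_w(T)ᵀ f̄_j‖²)^{1/2}` for an
orthonormal basis `f_j` of its column space (`norm_sq_hsInner_le_of_rank_le`), and the spectral bound
`∑_j ‖K_w(T)ᵀ f̄_j‖² ≤ 2r + 3n² + n(n % 2)` (`kwM_matMul_bessel`: `K Kᵀ = 1 + 3E`, `rank E = n²`) with
Cauchy–Schwarz over `w` gives `36n²|⟨S,T⟩|² ≤ n² · (2r + 3n² + n(n%2)) · 6n‖S‖²`.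

References: J. M. Landsberg, G. Ottaviani, Theory of Computing 11 (2015), Thm 2.1; V. Strassen,
J. reine angew. Math. 375/376 (1987); P. Bürgisser, M. Clausen, M. A. Shokrollahi, Algebraic Complexity
Theory (1997), Cor. (19.14).
-/

set_option linter.dupNamespace false

noncomputable section

namespace Summit.MatrixMultiplication.MatrixMultiplication.Theorems.DiagonalPowerDecay

open scoped BigOperators ComplexConjugate InnerProductSpace
open Literature.Computability.AlgebraicComplexity Module

/-! ## Hilbert–Schmidt pairing against a low-rank matrix -/

/-- **Low-rank pairing bound.** If `rank M ≤ k` and every orthonormal family `f₁,…,f_m` (`m ≤ k`) of row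
vectors has `∑_j ‖Kᵀ f̄_j‖² ≤ B`, then `|⟨M, K⟩_HS|² ≤ ‖M‖²_HS · B` (expand the columns of `M` in an
orthonormal basis of its column space, Cauchy–Schwarz). [folklore] -/
theorem norm_sq_hsInner_le_of_rank_le {ρ γ : Type*} [Fintype ρ] [Fintype γ] [DecidableEq ρ]
    [DecidableEq γ] (M K : Matrix ρ γ ℂ) (k : ℕ) (hM : M.rank ≤ k) (B : ℝ)
    (hB : ∀ (m : ℕ) (f : Fin m → EuclideanSpace ℂ ρ), Orthonormal ℂ f → m ≤ k →
      ∑ j, ∑ q, ‖∑ p, conj (f j p) * K p q‖ ^ 2 ≤ B) :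
    ‖∑ p, ∑ q, conj (M p q) * K p q‖ ^ 2 ≤ (∑ p, ∑ q, ‖M p q‖ ^ 2) * B := by
  classical
  -- the columns of `M` in the Hermitian space `ℂ^ρ` and their span
  let col : γ → EuclideanSpace ℂ ρ := fun q => WithLp.toLp 2 (fun p => M p q)
  let W : Submodule ℂ (EuclideanSpace ℂ ρ) := Submodule.span ℂ (Set.range col)
  have hcolW : ∀ q, col q ∈ W := fun q => Submodule.subset_span ⟨q, rfl⟩
  -- `dim W = rank M ≤ k`
  have hWk : finrank ℂ W ≤ k := by
    let e : (ρ → ℂ) ≃ₗ[ℂ] EuclideanSpace ℂ ρ := (WithLp.linearEquiv 2 ℂ (ρ → ℂ)).symm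
    have hrange : Set.range col = e '' Set.range M.col := by
      rw [← Set.range_comp]; rfl
    have hW : W = (Submodule.span ℂ (Set.range M.col)).map (e : (ρ → ℂ) →ₗ[ℂ] EuclideanSpace ℂ ρ) := by
      rw [Submodule.map_span, LinearEquiv.coe_coe, ← hrange]
    rw [hW, LinearEquiv.finrank_map_eq, ← Matrix.rank_eq_finrank_span_cols]
    exact hM
  -- an orthonormal basis of `W`
  set m := finrank ℂ W with hmdef
  let ob : OrthonormalBasis (Fin m) ℂ W := stdOrthonormalBasis ℂ W
  let f : Fin m → EuclideanSpace ℂ ρ := fun j => (ob j : EuclideanSpace ℂ ρ)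
  have hf : Orthonormal ℂ f := ob.orthonormal.comp_linearIsometry W.subtypeₗᵢ
  let coef : Fin m → γ → ℂ := fun j q => ⟪f j, col q⟫_ℂ
  -- expansion of the columns
  have hexp : ∀ q p, M p q = ∑ j, coef j q * f j p := by
    intro q p
    have hx := ob.sum_repr' ⟨col q, hcolW q⟩
    have hx' := congrArg (fun x : W => (x : EuclideanSpace ℂ ρ) p) hx
    simp only [Submodule.coe_sum, Submodule.coe_smul, WithLp.ofLp_sum, WithLp.ofLp_smul,
      Finset.sum_apply, Pi.smul_apply, smul_eq_mul, Submodule.coe_inner] at hx'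
    simpa [col] using hx'.symm
  -- Parseval for each column
  have hpars : ∀ q, ∑ j, ‖coef j q‖ ^ 2 = ∑ p, ‖M p q‖ ^ 2 := by
    intro q
    have h1 : ‖ob.repr ⟨col q, hcolW q⟩‖ = ‖(⟨col q, hcolW q⟩ : W)‖ := ob.repr.norm_map _
    have h2 : ‖ob.repr ⟨col q, hcolW q⟩‖ ^ 2 = ‖(⟨col q, hcolW q⟩ : W)‖ ^ 2 := by rw [h1]
    rw [EuclideanSpace.norm_sq_eq, Submodule.coe_norm, EuclideanSpace.norm_sq_eq] at h2
    simp only [ob.repr_apply_apply, Submodule.coe_inner] at h2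
    simpa [col] using h2
  -- the pairing as a single sum over `(q, j)`
  let X : γ × Fin m → ℂ := fun x => conj (coef x.2 x.1)
  let Y : γ × Fin m → ℂ := fun x => ∑ p, conj (f x.2 p) * K p x.1
  have hip : ∑ p, ∑ q, conj (M p q) * K p q = ∑ x, X x * Y x := by
    rw [Finset.sum_comm, Fintype.sum_prod_type]
    refine Finset.sum_congr rfl fun q _ => ?_
    simp only [X, Y]
    simp_rw [hexp q, map_sum, map_mul, Finset.sum_mul, Finset.mul_sum]
    rw [Finset.sum_comm]
    exact Finset.sum_congr rfl fun j _ => Finset.sum_congr rfl fun p _ => by ring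
  -- Cauchy–Schwarz
  have hCS : ‖∑ x, X x * Y x‖ ^ 2 ≤ (∑ x, ‖X x‖ ^ 2) * ∑ x, ‖Y x‖ ^ 2 := by
    have h1 : ‖∑ x, X x * Y x‖ ≤ ∑ x, ‖X x‖ * ‖Y x‖ :=
      (norm_sum_le _ _).trans (le_of_eq (Finset.sum_congr rfl fun x _ => norm_mul _ _))
    calc ‖∑ x, X x * Y x‖ ^ 2 ≤ (∑ x, ‖X x‖ * ‖Y x‖) ^ 2 :=
          pow_le_pow_left₀ (norm_nonneg _) h1 2
      _ ≤ (∑ x, ‖X x‖ ^ 2) * ∑ x, ‖Y x‖ ^ 2 := Finset.sum_mul_sq_le_sq_mul_sq _ _ _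
  have hX : ∑ x, ‖X x‖ ^ 2 = ∑ p, ∑ q, ‖M p q‖ ^ 2 := by
    rw [Fintype.sum_prod_type]
    simp only [X, Complex.norm_conj]
    simp_rw [hpars]
    rw [Finset.sum_comm]
  have hY : ∑ x, ‖Y x‖ ^ 2 ≤ B := by
    rw [Fintype.sum_prod_type, Finset.sum_comm]
    exact hB m f hf hWk
  have h0 : 0 ≤ ∑ p, ∑ q, ‖M p q‖ ^ 2 :=
    Finset.sum_nonneg fun p _ => Finset.sum_nonneg fun q _ => by positivity
  calc ‖∑ p, ∑ q, conj (M p q) * K p q‖ ^ 2 = ‖∑ x, X x * Y x‖ ^ 2 := by rw [hip]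
    _ ≤ (∑ x, ‖X x‖ ^ 2) * ∑ x, ‖Y x‖ ^ 2 := hCS
    _ ≤ (∑ p, ∑ q, ‖M p q‖ ^ 2) * B := by rw [hX]; gcongr

/-! ## The witness -/

/-- `⟨n,n,n⟩` has real (`0/1`) entries. [cite: Blaser2013, §5 (the tensor ⟨k,m,n⟩)] -/
theorem conj_matMulTensor (n : ℕ) (a : Fin n × Fin n) (b : Fin n × Fin n) (c : Fin n × Fin n) :
    conj (matMulTensor ℂ n n n a b c) = matMulTensor ℂ n n n a b c := by
  unfold matMulTensor
  split_ifs <;> simp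

/-- **The quantitative Koszul-flattening witness** (support for crux `DiagonalPowerDecay`,
stmt-MatrixMultiplication-14053): for every `n, r` and every `S` of tensor rank `≤ r`,
`|⟨S,⟨n,n,n⟩⟩|² ≤ n(2r + 3n² + n(n % 2))/6 · ‖S‖²`; in particular `M(n,n²) ≤ (5/6)n³` for even `n`.
[cite: LandsbergOttaviani2015, Thm 2.1] -/
theorem koszulWitness (n r : ℕ) (S : (Fin n × Fin n) → (Fin n × Fin n) → (Fin n × Fin n) → ℂ)
    (hS : tensorRank S ≤ r) :
    ‖∑ a, ∑ b, ∑ c, S a b c * matMulTensor ℂ n n n a b c‖ ^ 2 ≤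
      ((n : ℝ) * (2 * r + 3 * n ^ 2 + n * (n % 2 : ℕ)) / 6) * ∑ a, ∑ b, ∑ c, ‖S a b c‖ ^ 2 := by
  classical
  rcases Nat.eq_zero_or_pos n with rfl | hn
  · simp
  haveI : NeZero n := ⟨by omega⟩
  set B : ℝ := 2 * r + 3 * n ^ 2 + n * (n % 2 : ℕ) with hBdef
  have hB0 : 0 ≤ B := by rw [hBdef]; positivity
  -- (1) the isometric twirl: `∑_w ⟨M_w, K_w(t₂)⟩ = 6n ⟨S, t₂⟩`
  have hframe : ∀ t₂ : (Fin n × Fin n) → (Fin n × Fin n) → (Fin n × Fin n) → ℂ,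
      ∑ w : Fin n × Fin n, ∑ p : Fin 3 × (Fin n × Fin n), ∑ q : Fin 3 × (Fin n × Fin n), conj (kwM (kwProj w) S p q) * kwM (kwProj w) t₂ p q =
        6 * (n : ℂ) * ∑ a, ∑ b, ∑ c, conj (S a b c) * t₂ a b c := by
    intro t₂
    simp_rw [kwM_inner]
    rw [← Finset.mul_sum]
    have h1 : ∑ w : Fin n × Fin n, ∑ c, ∑ b, ∑ j : Fin (2 * 1 + 1),
        conj (kwProj w (fun a => S a b c) j) * kwProj w (fun a => t₂ a b c) j =
        ∑ c, ∑ b, 3 * (n : ℂ) * ∑ a, conj (S a b c) * t₂ a b c := by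
      rw [Finset.sum_comm]
      refine Finset.sum_congr rfl fun c _ => ?_
      rw [Finset.sum_comm]
      refine Finset.sum_congr rfl fun b _ => ?_
      exact kwProj_frame _ _
    rw [h1]
    have h2 : ∑ a, ∑ b, ∑ c, conj (S a b c) * t₂ a b c = ∑ c, ∑ b, ∑ a, conj (S a b c) * t₂ a b c := by
      have s1 : ∀ a, ∑ b, ∑ c, conj (S a b c) * t₂ a b c = ∑ c, ∑ b, conj (S a b c) * t₂ a b c :=
        fun a => Finset.sum_comm
      simp_rw [s1]
      rw [Finset.sum_comm]
      exact Finset.sum_congr rfl fun c _ => Finset.sum_comm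
    rw [h2, Finset.mul_sum]
    simp_rw [Finset.mul_sum]
    exact Finset.sum_congr rfl fun _ _ => Finset.sum_congr rfl fun _ _ =>
      Finset.sum_congr rfl fun _ _ => by ring
  have hN : ∑ w : Fin n × Fin n, ∑ p : Fin 3 × (Fin n × Fin n), ∑ q : Fin 3 × (Fin n × Fin n), ‖kwM (kwProj w) S p q‖ ^ 2 =
      6 * (n : ℝ) * ∑ a, ∑ b, ∑ c, ‖S a b c‖ ^ 2 := by
    have h := hframe S
    apply Complex.ofReal_injective
    push_cast
    simp_rw [← Complex.conj_mul']
    exact h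
  -- (2) the per-`w` bound from rank `≤ 2r` and the spectral bound
  have hP : ∀ w : Fin n × Fin n,
      ‖∑ p : Fin 3 × (Fin n × Fin n), ∑ q : Fin 3 × (Fin n × Fin n), conj (kwM (kwProj w) S p q) * kwM (kwProj w) (matMulTensor ℂ n n n) p q‖ ^ 2 ≤
        (∑ p : Fin 3 × (Fin n × Fin n), ∑ q : Fin 3 × (Fin n × Fin n), ‖kwM (kwProj w) S p q‖ ^ 2) * B := by
    intro w
    refine norm_sq_hsInner_le_of_rank_le (kwM (kwProj w) S) (kwM (kwProj w) (matMulTensor ℂ n n n)) (2 * r)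
      ((kwM_rank_le (kwProj w) S).trans (Nat.mul_le_mul_left 2 hS)) B ?_
    intro m f hf hm
    refine (kwM_matMul_bessel w f hf).trans ?_
    rw [hBdef]
    have : (m : ℝ) ≤ 2 * r := by exact_mod_cast hm
    linarith
  -- (3) Cauchy–Schwarz over `w`
  have hN0 : ∀ w : Fin n × Fin n, 0 ≤ ∑ p : Fin 3 × (Fin n × Fin n), ∑ q : Fin 3 × (Fin n × Fin n), ‖kwM (kwProj w) S p q‖ ^ 2 :=
    fun w => Finset.sum_nonneg fun p _ => Finset.sum_nonneg fun q _ => by positivity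
  have hroot : ∀ w : Fin n × Fin n,
      ‖∑ p : Fin 3 × (Fin n × Fin n), ∑ q : Fin 3 × (Fin n × Fin n), conj (kwM (kwProj w) S p q) * kwM (kwProj w) (matMulTensor ℂ n n n) p q‖ ≤
        Real.sqrt ((∑ p : Fin 3 × (Fin n × Fin n), ∑ q : Fin 3 × (Fin n × Fin n), ‖kwM (kwProj w) S p q‖ ^ 2) * B) := by
    intro w
    have := Real.abs_le_sqrt (hP w)
    rwa [abs_norm] at this
  have hsum : ‖∑ w : Fin n × Fin n, ∑ p : Fin 3 × (Fin n × Fin n), ∑ q : Fin 3 × (Fin n × Fin n), conj (kwM (kwProj w) S p q) * kwM (kwProj w) (matMulTensor ℂ n n n) p q‖ ≤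
      ∑ w : Fin n × Fin n, Real.sqrt ((∑ p : Fin 3 × (Fin n × Fin n), ∑ q : Fin 3 × (Fin n × Fin n), ‖kwM (kwProj w) S p q‖ ^ 2) * B) :=
    (norm_sum_le _ _).trans (Finset.sum_le_sum fun w _ => hroot w)
  have hsq : (∑ w : Fin n × Fin n, Real.sqrt ((∑ p : Fin 3 × (Fin n × Fin n), ∑ q : Fin 3 × (Fin n × Fin n), ‖kwM (kwProj w) S p q‖ ^ 2) * B)) ^ 2 ≤
      ((n : ℝ) * n) * (B * (6 * (n : ℝ) * ∑ a, ∑ b, ∑ c, ‖S a b c‖ ^ 2)) := by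
    calc (∑ w : Fin n × Fin n, Real.sqrt ((∑ p : Fin 3 × (Fin n × Fin n), ∑ q : Fin 3 × (Fin n × Fin n), ‖kwM (kwProj w) S p q‖ ^ 2) * B)) ^ 2
        ≤ (Finset.univ : Finset (Fin n × Fin n)).card *
            ∑ w : Fin n × Fin n, (Real.sqrt ((∑ p : Fin 3 × (Fin n × Fin n), ∑ q : Fin 3 × (Fin n × Fin n), ‖kwM (kwProj w) S p q‖ ^ 2) * B)) ^ 2 :=
          sq_sum_le_card_mul_sum_sq
      _ = ((n : ℝ) * n) * (B * ∑ w : Fin n × Fin n, ∑ p : Fin 3 × (Fin n × Fin n), ∑ q : Fin 3 × (Fin n × Fin n), ‖kwM (kwProj w) S p q‖ ^ 2) := by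
          rw [Finset.card_univ, Fintype.card_prod, Fintype.card_fin]
          push_cast
          congr 1
          rw [Finset.mul_sum]
          refine Finset.sum_congr rfl fun w _ => ?_
          rw [Real.sq_sqrt (mul_nonneg (hN0 w) hB0)]
          ring
      _ = ((n : ℝ) * n) * (B * (6 * (n : ℝ) * ∑ a, ∑ b, ∑ c, ‖S a b c‖ ^ 2)) := by rw [hN]
  -- (4) assemble
  have hconj : ‖∑ a, ∑ b, ∑ c, S a b c * matMulTensor ℂ n n n a b c‖ =
      ‖∑ a, ∑ b, ∑ c, conj (S a b c) * matMulTensor ℂ n n n a b c‖ := by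
    rw [← Complex.norm_conj]
    simp only [map_sum, map_mul, conj_matMulTensor]
  have hmain : (6 * (n : ℝ)) ^ 2 * ‖∑ a, ∑ b, ∑ c, S a b c * matMulTensor ℂ n n n a b c‖ ^ 2 ≤
      ((n : ℝ) * n) * (B * (6 * (n : ℝ) * ∑ a, ∑ b, ∑ c, ‖S a b c‖ ^ 2)) := by
    rw [hconj, ← mul_pow]
    have e6 : 6 * (n : ℝ) * ‖∑ a, ∑ b, ∑ c, conj (S a b c) * matMulTensor ℂ n n n a b c‖ =
        ‖∑ w : Fin n × Fin n, ∑ p : Fin 3 × (Fin n × Fin n), ∑ q : Fin 3 × (Fin n × Fin n), conj (kwM (kwProj w) S p q) * kwM (kwProj w) (matMulTensor ℂ n n n) p q‖ := by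
      rw [hframe (matMulTensor ℂ n n n), norm_mul]
      congr 1
      simp
    rw [e6]
    exact (pow_le_pow_left₀ (norm_nonneg _) hsum 2).trans hsq
  have hn0 : (0 : ℝ) < n := by exact_mod_cast hn
  have hS0 : 0 ≤ ∑ a, ∑ b, ∑ c, ‖S a b c‖ ^ 2 :=
    Finset.sum_nonneg fun a _ => Finset.sum_nonneg fun b _ => Finset.sum_nonneg fun c _ => by positivity
  have h36 : (0 : ℝ) < (6 * n) ^ 2 := by positivity
  have hfin : (6 * (n : ℝ)) ^ 2 * ‖∑ a, ∑ b, ∑ c, S a b c * matMulTensor ℂ n n n a b c‖ ^ 2 ≤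
      (6 * (n : ℝ)) ^ 2 * ((n : ℝ) * B / 6 * ∑ a, ∑ b, ∑ c, ‖S a b c‖ ^ 2) :=
    hmain.trans_eq (by ring)
  exact le_of_mul_le_mul_left hfin h36

/-- **The diagonal value** (`r = n²`, the crux's budget): `|⟨S,⟨n,n,n⟩⟩|² ≤ (5n³ + n²(n % 2))/6 · ‖S‖²`
for every `S` of rank `≤ n²`, i.e. `φ(n) = M(n,n²)/n³ ≤ 5/6 + (n % 2)/(6n)`. [cite: LandsbergOttaviani2015, Thm 2.1] -/
theorem koszulWitness_sq (n : ℕ) (S : (Fin n × Fin n) → (Fin n × Fin n) → (Fin n × Fin n) → ℂ)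
    (hS : tensorRank S ≤ n ^ 2) :
    ‖∑ a, ∑ b, ∑ c, S a b c * matMulTensor ℂ n n n a b c‖ ^ 2 ≤
      ((5 * (n : ℝ) ^ 3 + (n : ℝ) ^ 2 * (n % 2 : ℕ)) / 6) * ∑ a, ∑ b, ∑ c, ‖S a b c‖ ^ 2 := by
  have h := koszulWitness n (n ^ 2) S hS
  have e : ((n : ℝ) * (2 * ((n ^ 2 : ℕ) : ℝ) + 3 * n ^ 2 + n * (n % 2 : ℕ)) / 6) =
      (5 * (n : ℝ) ^ 3 + (n : ℝ) ^ 2 * (n % 2 : ℕ)) / 6 := by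
    push_cast; ring
  rwa [e] at h

/-- **Gap form** (the shape of the route's witness statements): for `n ≥ 1` and `R(S) ≤ r`,
`|⟨S,⟨n,n,n⟩⟩|² ≤ (1 − ε(n,r))·n³·‖S‖²` with the EXPLICIT fidelity gap
`ε(n,r) = (3n² − 2r − n(n % 2))/(6n²)` — positive for every budget `r < (3n² − n(n%2))/2`, equal to
`1/6 − (n % 2)/(6n)` at the crux's budget `r = n²`. [cite: LandsbergOttaviani2015, Thm 2.1] -/
theorem koszulWitness_gap {n : ℕ} (hn : 1 ≤ n) (r : ℕ)
    (S : (Fin n × Fin n) → (Fin n × Fin n) → (Fin n × Fin n) → ℂ) (hS : tensorRank S ≤ r) :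
    ‖∑ a, ∑ b, ∑ c, S a b c * matMulTensor ℂ n n n a b c‖ ^ 2 ≤
      (1 - (3 * (n : ℝ) ^ 2 - 2 * r - n * (n % 2 : ℕ)) / (6 * (n : ℝ) ^ 2)) * (n : ℝ) ^ 3 *
        ∑ a, ∑ b, ∑ c, ‖S a b c‖ ^ 2 := by
  have h := koszulWitness n r S hS
  have hn0 : (n : ℝ) ≠ 0 := by exact_mod_cast (Nat.one_le_iff_ne_zero.1 hn)
  have e : ((n : ℝ) * (2 * r + 3 * n ^ 2 + n * (n % 2 : ℕ)) / 6) =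
      (1 - (3 * (n : ℝ) ^ 2 - 2 * r - n * (n % 2 : ℕ)) / (6 * (n : ℝ) ^ 2)) * (n : ℝ) ^ 3 := by
    field_simp
    ring
  rwa [e] at h

/-- **Even formats: `φ(n) ≤ 5/6`.** For even `n` and every `S` of rank `≤ n²`,
`|⟨S,⟨n,n,n⟩⟩|² ≤ (5/6)·n³·‖S‖²`. [cite: LandsbergOttaviani2015, Thm 2.1] -/
theorem koszulWitness_even {n : ℕ} (hn : Even n)
    (S : (Fin n × Fin n) → (Fin n × Fin n) → (Fin n × Fin n) → ℂ) (hS : tensorRank S ≤ n ^ 2) :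
    ‖∑ a, ∑ b, ∑ c, S a b c * matMulTensor ℂ n n n a b c‖ ^ 2 ≤
      (5 / 6) * (n : ℝ) ^ 3 * ∑ a, ∑ b, ∑ c, ‖S a b c‖ ^ 2 := by
  have h := koszulWitness_sq n S hS
  have h0 : n % 2 = 0 := Nat.even_iff.1 hn
  rw [h0] at h
  simpa [mul_comm, mul_left_comm, mul_assoc, div_eq_mul_inv] using h

/-- **Uniform bound: `φ(n) ≤ 8/9` for all `n ≥ 2`.** For every `n ≥ 2` and every `S` of rank `≤ n²`,
`|⟨S,⟨n,n,n⟩⟩|² ≤ (8/9)·n³·‖S‖²` — `n²` (border) multiplications capture at most `8/9` of the `n³` unit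
products of `n × n` matrix multiplication, uniformly in `n` (the crux `DiagonalPowerDecay` asks for
`C·n^{-2δ}` in place of `8/9`). [cite: LandsbergOttaviani2015, Thm 2.1] -/
theorem koszulWitness_uniform {n : ℕ} (hn : 2 ≤ n)
    (S : (Fin n × Fin n) → (Fin n × Fin n) → (Fin n × Fin n) → ℂ) (hS : tensorRank S ≤ n ^ 2) :
    ‖∑ a, ∑ b, ∑ c, S a b c * matMulTensor ℂ n n n a b c‖ ^ 2 ≤
      (8 / 9) * (n : ℝ) ^ 3 * ∑ a, ∑ b, ∑ c, ‖S a b c‖ ^ 2 := by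
  have h := koszulWitness_sq n S hS
  have hS0 : 0 ≤ ∑ a, ∑ b, ∑ c, ‖S a b c‖ ^ 2 :=
    Finset.sum_nonneg fun a _ => Finset.sum_nonneg fun b _ => Finset.sum_nonneg fun c _ => by positivity
  refine h.trans (mul_le_mul_of_nonneg_right ?_ hS0)
  -- `(5n³ + n²(n%2))/6 ≤ (8/9) n³` iff `3 n² (n%2) ≤ n³`, true for `n ≥ 3` and for `n = 2`
  have hmod : (n % 2 : ℕ) ≤ 1 := Nat.lt_succ_iff.1 (Nat.mod_lt n (by norm_num))
  have hn' : (2 : ℝ) ≤ n := by exact_mod_cast hn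
  rcases Nat.lt_or_ge n 3 with h3 | h3
  · have h2 : n = 2 := by omega
    subst h2
    norm_num
  · have h3' : (3 : ℝ) ≤ n := by exact_mod_cast h3
    have hm' : ((n % 2 : ℕ) : ℝ) ≤ 1 := by exact_mod_cast hmod
    have hn2 : (0 : ℝ) ≤ (n : ℝ) ^ 2 := by positivity
    nlinarith [mul_le_mul_of_nonneg_left hm' hn2]

end Summit.MatrixMultiplication.MatrixMultiplication.Theorems.DiagonalPowerDecay

end
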